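import Summits.AtomisticToContinuum.Crystallization.Theorems.ChargedEnergyGapAffineChargingA
import HarnessLib

/-!
# NODE 65 «AffineChart» part 29b: affine charging — strain bound, affine bond/site forms, core kernel, excision splits, site completion, core refold, ★★★ P-Xᵃ geometric charging form, affine sub-family glue — part 2 of 3 (sequel of `…ChargedEnergyGapAffineChargingA`)

Split for the 400-line cap by the landing lane (hand-2 g33); the module docstring of part 1 (`…ChargedEnergyGapAffineChargingA`) describes the whole node.  Same namespace; all FQNs unchanged.
0 sorry; standard axioms.
-/

noncomputable section
open scoped Classical
open Literature.MathematicalPhysics.StatisticalMechanics Literature.Geometry.DiscreteGeometry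
open Summit.AtomisticToContinuum.Crystallization.Theses.PricedLinkCensus
open Summit.AtomisticToContinuum.Crystallization.Theorems.ChargedEnergyGapNegative

namespace Summit.AtomisticToContinuum.Crystallization.Theorems.ChargedEnergyGapChartDial

section BondBounds

/-- `V′(t) ≥ 0` for `t ≥ 1` (tension regime). -/
theorem ljD1_nonneg_of_one_le {t : ℝ} (ht : 1 ≤ t) : 0 ≤ ljD1 t := by
  unfold ljD1
  have h0 : 0 ≤ t⁻¹ := inv_nonneg.2 (by linarith)
  have h1 : t⁻¹ ≤ 1 := inv_le_one_of_one_le₀ ht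
  nlinarith [pow_le_pow_of_le_one h0 h1 (show 7 ≤ 13 by norm_num)]

/-- `V″(t) ≤ 0` for `t ≥ 2` (the LJ bond is longitudinally SOFTENING beyond the inflection point `(13/7)^{1/6} ≈ 1.11`). -/
theorem ljD2_nonpos_of_two_le {t : ℝ} (ht : 2 ≤ t) : ljD2 t ≤ 0 := by
  unfold ljD2
  have ht0 : 0 < t := by linarith
  have h0 : 0 < t⁻¹ := inv_pos.2 ht0
  have h1 : t⁻¹ ≤ 1 / 2 := by rw [one_div]; exact inv_anti₀ (by norm_num) ht
  have h6 : (t⁻¹) ^ 6 ≤ (1 / 2) ^ 6 := pow_le_pow_left₀ h0.le h1 6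
  have h8 : 0 < (t⁻¹) ^ 8 := pow_pos h0 8
  have : (t⁻¹) ^ 14 = (t⁻¹) ^ 8 * (t⁻¹) ^ 6 := by ring
  rw [this]
  nlinarith

variable (P : PeriodicConfiguration 3) (A : E3 →ₗ[ℝ] E3) (y : E3)

/-- ★ FAR LINEAR DEBIT: for a bond of length `d ≥ 1`, `bondLin(affineField A) ≤ b·(V′)⁺(d)·d` whenever `|⟪x, A x⟫| ≤ b‖x‖²`. -/
theorem bondLin_affineField_le_far {b : ℝ} (hb : ∀ x, |inner ℝ x (A x)| ≤ b * ‖x‖ ^ 2) {z : E3} (hz : z ≠ y) (hd : 1 ≤ dist y z) :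
    bondLin (affineField A) y z ≤ b * (max (ljD1 (dist y z)) 0 * dist y z) := by
  rw [bondLin_affineField]
  have hd0 : 0 < dist y z := dist_pos.2 hz.symm
  set d := dist y z with hd_def
  have hx : ‖z - y‖ = d := by rw [hd_def, dist_eq_norm, norm_sub_rev]
  have hV : 0 ≤ ljD1 d := ljD1_nonneg_of_one_le hd
  rw [max_eq_left hV]
  have h1 : inner ℝ (z - y) (A (z - y)) ≤ b * d ^ 2 := by
    have h := (le_abs_self _).trans (hb (z - y))
    rwa [hx] at h
  calc ljD1 d / d * inner ℝ (z - y) (A (z - y)) ≤ ljD1 d / d * (b * d ^ 2) :=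
        mul_le_mul_of_nonneg_left h1 (div_nonneg hV hd0.le)
    _ = b * (ljD1 d * d) * (d⁻¹ * d) := by rw [div_eq_mul_inv]; ring
    _ = b * (ljD1 d * d) := by rw [inv_mul_cancel₀ hd0.ne', mul_one]

/-- ★ FAR QUADRATIC DEBIT: for a bond of length `d ≥ 2` (softening regime `V″ ≤ 0`), `bondQuad(affineField A) ≤ a²·(V′)⁺(d)·d`
whenever `‖A x‖ ≤ a‖x‖`. -/
theorem bondQuad_affineField_le_far {a : ℝ} (ha : ∀ x, ‖A x‖ ≤ a * ‖x‖) {z : E3} (hz : z ≠ y) (hd : 2 ≤ dist y z) :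
    bondQuad (affineField A) y z ≤ a ^ 2 * (max (ljD1 (dist y z)) 0 * dist y z) := by
  unfold bondQuad
  rw [affineField_apply]
  have hd0 : 0 < dist y z := dist_pos.2 hz.symm
  set d := dist y z with hd_def
  have hx : ‖z - y‖ = d := by rw [hd_def, dist_eq_norm, norm_sub_rev]
  have hV : 0 ≤ ljD1 d := ljD1_nonneg_of_one_le (by linarith)
  have hV2 : ljD2 d ≤ 0 := ljD2_nonpos_of_two_le hd
  rw [max_eq_left hV]
  set q := inner ℝ (d⁻¹ • (z - y)) (A (z - y))
  set w := ‖A (z - y)‖ with hw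
  have hwa : w ≤ a * d := by rw [hw, ← hx]; exact ha _
  have hw0 : 0 ≤ w := norm_nonneg _
  have h1 : ljD2 d * q ^ 2 ≤ 0 := mul_nonpos_of_nonpos_of_nonneg hV2 (sq_nonneg q)
  have h2 : ljD1 d / d * (w ^ 2 - q ^ 2) ≤ ljD1 d / d * (a * d) ^ 2 := by
    refine mul_le_mul_of_nonneg_left ?_ (div_nonneg hV hd0.le)
    nlinarith [sq_nonneg q, pow_le_pow_left₀ hw0 hwa 2]
  calc ljD2 d * q ^ 2 + ljD1 d / d * (w ^ 2 - q ^ 2) ≤ 0 + ljD1 d / d * (a * d) ^ 2 := add_le_add h1 h2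
    _ = a ^ 2 * (ljD1 d * d) * (d⁻¹ * d) := by rw [div_eq_mul_inv]; ring
    _ = a ^ 2 * (ljD1 d * d) := by rw [inv_mul_cancel₀ hd0.ne', mul_one]

end BondBounds

section SiteCompletion

variable {P : PeriodicConfiguration 3} (X N : Set E3) (A : E3 →ₗ[ℝ] E3) {y : E3} {lamQ a b R : ℝ}

/-- ★★ **THE EXCISED AFFINE SITE TERM, BOUNDED BELOW**: at a site-stress-free motif site `y`, for an affine field with `‖A x‖ ≤ a‖x‖`,
`|⟪x, A x⟫| ≤ b‖x‖²`, `λ ≥ 0`, and a set `N` (the «near zone») such that every excised `z ∉ N` is at distance `≥ R ≥ 2` from `y`: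
`l^X_y + λ q^X_y ≥ λ·q^∅_y(A) − (b/2 + λa²/4)·E_{X∖N}(y) − (a/2 + 7λa²/2)·K_{X∩N}(y)` (excision splits + the far/near bond debits). -/
theorem affine_site_ge (hS : IsSiteStressFree P) (hy : y ∈ P.motif) (hlam : 0 ≤ lamQ) (ha0 : 0 ≤ a)
    (ha : ∀ x, ‖A x‖ ≤ a * ‖x‖) (hb : ∀ x, |inner ℝ x (A x)| ≤ b * ‖x‖ ^ 2) (hR : 2 ≤ R)
    (hfar : ∀ z ∈ P.points, z ∈ X → z ∉ N → R ≤ dist y z) :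
    lamQ * quadSite (affineField A) P ∅ y - (b / 2 + lamQ * a ^ 2 / 4) * excisionSum P (X \ N) y -
        (a / 2 + 7 / 2 * lamQ * a ^ 2) * coreSum P (X ∩ N) y ≤
      linSite (affineField A) P X y + lamQ * quadSite (affineField A) P X y := by
  have hsL := summable_bondLin_affineField P A y ha
  have hsQ := summable_bondQuad_affineField P A y ha
  rw [linSite_eq_empty_sub _ P X y hsL, quadSite_eq_empty_sub _ P X y hsQ, linSite_affineField_empty_eq_zero A hS hy]
  have hl4 : 0 ≤ lamQ / 4 := by positivity
  -- (name the two targets, so that every `if` below carries the classical `Decidable` instance of the definitions)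
  set Y₁ : Set E3 := X \ N with hY₁def
  set Y₂ : Set E3 := X ∩ N with hY₂def
  have hY₁ : ∀ z, z ∈ Y₁ ↔ z ∈ X ∧ z ∉ N := fun z => by rw [hY₁def]; rfl
  have hY₂ : ∀ z, z ∈ Y₂ ↔ z ∈ X ∧ z ∈ N := fun z => by rw [hY₂def]; rfl
  clear_value Y₁ Y₂
  have hsLi : Summable fun z : {z : E3 // z ∈ P.points ∧ z ≠ y} => if (z : E3) ∈ X then bondLin (affineField A) y (z : E3) else 0 :=
    summable_ite_of_summable (fun z : {z : E3 // z ∈ P.points ∧ z ≠ y} => bondLin (affineField A) y (z : E3)) (fun z => (z : E3) ∈ X) hsL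
  have hsQi : Summable fun z : {z : E3 // z ∈ P.points ∧ z ≠ y} => if (z : E3) ∈ X then bondQuad (affineField A) y (z : E3) else 0 :=
    summable_ite_of_summable (fun z : {z : E3 // z ∈ P.points ∧ z ≠ y} => bondQuad (affineField A) y (z : E3)) (fun z => (z : E3) ∈ X) hsQ
  -- the excised integrand is dominated termwise by the far tension / near core debits
  have hIU : ∀ z : {z : E3 // z ∈ P.points ∧ z ≠ y},
      (1 / 2) * (if (z : E3) ∈ X then bondLin (affineField A) y (z : E3) else 0) +
          lamQ / 4 * (if (z : E3) ∈ X then bondQuad (affineField A) y (z : E3) else 0) ≤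
        (b / 2 + lamQ * a ^ 2 / 4) * (if (z : E3) ∈ Y₁ then max (ljD1 (dist y z)) 0 * dist y (z : E3) else 0) +
          (a / 2 + 7 / 2 * lamQ * a ^ 2) * (if (z : E3) ∈ Y₂ then coreKernel (dist y z) else 0) := by
    intro z
    have hzy : (z : E3) ≠ y := z.2.2
    have hd0 : 0 < dist y (z : E3) := dist_pos.2 fun h => hzy h.symm
    by_cases hzX : (z : E3) ∈ X
    · by_cases hzN : (z : E3) ∈ N
      · -- near: crude kernel bounds
        have h1 : (z : E3) ∈ Y₂ := (hY₂ _).2 ⟨hzX, hzN⟩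
        have h2 : (z : E3) ∉ Y₁ := fun h => ((hY₁ _).1 h).2 hzN
        rw [if_pos hzX, if_pos hzX, if_neg h2, if_pos h1, mul_zero, zero_add]
        have hL := (le_abs_self _).trans (abs_bondLin_affineField_le P A y ha z)
        have hQ := mul_le_mul_of_nonneg_left ((le_abs_self _).trans (abs_bondQuad_affineField_le P A y ha z)) hl4
        have hK : 0 ≤ coreKernel (dist y (z : E3)) := coreKernel_nonneg hd0
        unfold coreKernel at hK ⊢
        have hK2 := mul_nonneg ha0 hK
        linarith
      · -- far: tension bounds
        have h1 : (z : E3) ∈ Y₁ := (hY₁ _).2 ⟨hzX, hzN⟩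
        have h2 : (z : E3) ∉ Y₂ := fun h => hzN ((hY₂ _).1 h).2
        rw [if_pos hzX, if_pos hzX, if_pos h1, if_neg h2, mul_zero, add_zero]
        have hRd : R ≤ dist y (z : E3) := hfar z z.2.1 hzX hzN
        have hL := bondLin_affineField_le_far A y hb hzy (by linarith)
        have hQ := mul_le_mul_of_nonneg_left (bondQuad_affineField_le_far A y ha hzy (by linarith)) hl4
        linarith
    · have h1 : (z : E3) ∉ Y₁ := fun h => hzX ((hY₁ _).1 h).1
      have h2 : (z : E3) ∉ Y₂ := fun h => hzX ((hY₂ _).1 h).1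
      rw [if_neg hzX, if_neg hzX, if_neg h1, if_neg h2, mul_zero, mul_zero, mul_zero, mul_zero, add_zero]
  have hsI : Summable fun z : {z : E3 // z ∈ P.points ∧ z ≠ y} =>
      (1 / 2) * (if (z : E3) ∈ X then bondLin (affineField A) y (z : E3) else 0) +
        lamQ / 4 * (if (z : E3) ∈ X then bondQuad (affineField A) y (z : E3) else 0) :=
    (hsLi.mul_left (1 / 2)).add (hsQi.mul_left (lamQ / 4))
  have hsU : Summable fun z : {z : E3 // z ∈ P.points ∧ z ≠ y} =>
      (b / 2 + lamQ * a ^ 2 / 4) * (if (z : E3) ∈ Y₁ then max (ljD1 (dist y z)) 0 * dist y (z : E3) else 0) +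
        (a / 2 + 7 / 2 * lamQ * a ^ 2) * (if (z : E3) ∈ Y₂ then coreKernel (dist y z) else 0) :=
    ((summable_excisionSummand P Y₁ y).mul_left _).add ((summable_coreSummand P Y₂ y).mul_left _)
  have hsum := Summable.tsum_le_tsum hIU hsI hsU
  rw [Summable.tsum_add (hsLi.mul_left _) (hsQi.mul_left _),
    Summable.tsum_add ((summable_excisionSummand P Y₁ y).mul_left _) ((summable_coreSummand P Y₂ y).mul_left _),
    tsum_mul_left, tsum_mul_left, tsum_mul_left, tsum_mul_left] at hsum
  have hE : excisionSum P Y₁ y = ∑' z : {z : E3 // z ∈ P.points ∧ z ≠ y},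
      (if (z : E3) ∈ Y₁ then max (ljD1 (dist y z)) 0 * dist y (z : E3) else 0) := rfl
  have hK : coreSum P Y₂ y = ∑' z : {z : E3 // z ∈ P.points ∧ z ≠ y},
      (if (z : E3) ∈ Y₂ then coreKernel (dist y z) else 0) := rfl
  rw [← hE, ← hK] at hsum
  linarith

/-- ★★ **SITEWISE COMPLETION OF THE SQUARE** (pure algebra): with `κb² ≤ Q`, `0 < λ`, `0 < κ`, `0 ≤ E ≤ F`:
`λQ − (b/2)E ≥ λκb² − (b/2)E ≥ −E²/(16λκ) ≥ −(F/(16λκ))·E`. -/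
theorem completion_of_square {Q b E F lamQ κ : ℝ} (hQ : κ * b ^ 2 ≤ Q) (hlam : 0 < lamQ) (hκ : 0 < κ) (hE : 0 ≤ E) (hEF : E ≤ F) :
    -(F / (16 * lamQ * κ) * E) ≤ lamQ * Q - b / 2 * E := by
  have h16 : 0 < 16 * lamQ * κ := by positivity
  have hsq : 0 ≤ lamQ * κ * (b - E / (4 * lamQ * κ)) ^ 2 := by positivity
  have hexp : lamQ * κ * (b - E / (4 * lamQ * κ)) ^ 2 = lamQ * κ * b ^ 2 - b / 2 * E + E ^ 2 / (16 * lamQ * κ) := by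
    field_simp
    ring
  have h1 : E ^ 2 / (16 * lamQ * κ) ≤ F / (16 * lamQ * κ) * E := by
    rw [div_mul_eq_mul_div, sq]
    exact div_le_div_of_nonneg_right (mul_le_mul_of_nonneg_right hEF hE) h16.le
  nlinarith

/-- ★★★ **THE AFFINE SITE BOUND**: under the hypotheses of `affine_site_ge`, sitewise stability `κb² ≤ q^∅_y(A)` (`κ > 0`, `λ > 0`) and the
far tail `E_{X∖N}(y) ≤ F`:  `l^X_y + λq^X_y ≥ −(F/(16λκ) + λa²/4)·E_{X∖N}(y) − (a/2 + 7λa²/2)·K_{X∩N}(y)`. -/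
theorem affine_site_bound (hS : IsSiteStressFree P) (hy : y ∈ P.motif) {κ F : ℝ} (hlam : 0 < lamQ) (hκ : 0 < κ) (ha0 : 0 ≤ a)
    (ha : ∀ x, ‖A x‖ ≤ a * ‖x‖) (hb : ∀ x, |inner ℝ x (A x)| ≤ b * ‖x‖ ^ 2) (hQ : κ * b ^ 2 ≤ quadSite (affineField A) P ∅ y)
    (hR : 2 ≤ R) (hfar : ∀ z ∈ P.points, z ∈ X → z ∉ N → R ≤ dist y z) (hF : excisionSum P (X \ N) y ≤ F) :
    -((F / (16 * lamQ * κ) + lamQ * a ^ 2 / 4) * excisionSum P (X \ N) y) - (a / 2 + 7 / 2 * lamQ * a ^ 2) * coreSum P (X ∩ N) y ≤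
      linSite (affineField A) P X y + lamQ * quadSite (affineField A) P X y := by
  have h1 := affine_site_ge X N A hS hy hlam.le ha0 ha hb hR hfar
  have h2 := completion_of_square hQ hlam hκ (excisionSum_nonneg P (X \ N) y) hF
  nlinarith [excisionSum_nonneg P (X \ N) y]

end SiteCompletion

/-! ## §H  The near-core debits refolded onto the priced excised sites -/
section CoreRefold

variable (ϱχ : ℝ) {m : ℕ} (D : Fin m → Set E3) (σ : Fin m → Bool) (P : PeriodicConfiguration 3) (X : Set E3) (ϱ : ℝ) (C : Set E3)

/-- The **CORE MASS INTO THE TARGET `Y`**: `Σ_{y ∈ F ∖ X} χ_σ(y)·w_C(y)·K_Y(y)` — the near-core debits of the affine instances, weighted like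
the model (`tensionMassL` with the core kernel `d⁻¹² + d⁻⁶` in place of the tension `(V′)⁺d`). -/
def coreMassL (Y : Set E3) : ℝ :=
  ∑ y ∈ P.motif, if y ∈ X then 0 else localFactor ϱχ D σ y * (profileWeight ϱ C y * coreSum P Y y)

/-- `coreMassL_nonneg` (docstring added by the landing lane; see the module docstring). [formal bookkeeping] -/
theorem coreMassL_nonneg (Y : Set E3) : 0 ≤ coreMassL ϱχ D σ P X ϱ C Y :=
  Finset.sum_nonneg fun y _ => by
    split_ifs
    · exact le_rfl
    · exact mul_nonneg (localFactor_nonneg (ϱχ := ϱχ) (D := D) (σ := σ) y)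
        (mul_nonneg (profileWeight_nonneg ϱ C y) (coreSum_nonneg P Y y))

/-- The RECEIVED CORE MASS of a site `z`: `Σ'_{y ∈ (F+Λ) ∖ X, y ≠ z} χ_σ(y)·w_C(y)·(d_yz⁻¹² + d_yz⁻⁶)`. -/
def receivedCore (z : E3) : ℝ :=
  ∑' y : {y : E3 // y ∈ P.points ∧ y ≠ z},
    if (y : E3) ∈ X then 0 else localFactor ϱχ D σ y * profileWeight ϱ C y * coreKernel (dist (y : E3) z)

/-- The universal core kernel at `z` is summable in the source variable. [formal bookkeeping] -/
theorem summable_coreKernel' (z : E3) : Summable fun y : {y : E3 // y ∈ P.points ∧ y ≠ z} => coreKernel (dist (y : E3) z) :=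
  (summable_coreKernel P z).congr fun y => by rw [dist_comm]

/-- `receivedCore_summand_nonneg` (docstring added by the landing lane; see the module docstring). [formal bookkeeping] -/
theorem receivedCore_summand_nonneg (z : E3) (y : {y : E3 // y ∈ P.points ∧ y ≠ z}) :
    0 ≤ (if (y : E3) ∈ X then 0 else localFactor ϱχ D σ y * profileWeight ϱ C y * coreKernel (dist (y : E3) z)) := by
  split_ifs
  · exact le_rfl
  · exact mul_nonneg (mul_nonneg (localFactor_nonneg (ϱχ := ϱχ) (D := D) (σ := σ) y) (profileWeight_nonneg ϱ C y))
      (coreKernel_nonneg (dist_pos.2 y.2.2))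

/-- `receivedCore_summand_le` (docstring added by the landing lane; see the module docstring). [formal bookkeeping] -/
theorem receivedCore_summand_le (z : E3) (y : {y : E3 // y ∈ P.points ∧ y ≠ z}) :
    (if (y : E3) ∈ X then 0 else localFactor ϱχ D σ y * profileWeight ϱ C y * coreKernel (dist (y : E3) z)) ≤
      coreKernel (dist (y : E3) z) := by
  have hK : 0 ≤ coreKernel (dist (y : E3) z) := coreKernel_nonneg (dist_pos.2 y.2.2)
  split_ifs
  · exact hK
  · have hχ := localFactor_nonneg (ϱχ := ϱχ) (D := D) (σ := σ) (y : E3)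
    have hχ1 := localFactor_le_one (ϱχ := ϱχ) (D := D) (σ := σ) (y : E3)
    have hw := profileWeight_nonneg ϱ C y
    have hw1 := profileWeight_le_one ϱ C y
    calc localFactor ϱχ D σ y * profileWeight ϱ C y * coreKernel (dist (y : E3) z) ≤ 1 * 1 * coreKernel (dist (y : E3) z) := by gcongr
      _ = _ := by ring

/-- `summable_receivedCore_summand` (docstring added by the landing lane; see the module docstring). [formal bookkeeping] -/
theorem summable_receivedCore_summand (z : E3) :
    Summable fun y : {y : E3 // y ∈ P.points ∧ y ≠ z} =>
      (if (y : E3) ∈ X then 0 else localFactor ϱχ D σ y * profileWeight ϱ C y * coreKernel (dist (y : E3) z)) :=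
  Summable.of_nonneg_of_le (receivedCore_summand_nonneg ϱχ D σ P X ϱ C z) (receivedCore_summand_le ϱχ D σ P X ϱ C z)
    (summable_coreKernel' P z)

/-- The received core mass is at most the universal core sum at `z` (weights `≤ 1`). -/
theorem receivedCore_le_univ (z : E3) :
    receivedCore ϱχ D σ P X ϱ C z ≤ ∑' y : {y : E3 // y ∈ P.points ∧ y ≠ z}, coreKernel (dist (y : E3) z) :=
  Summable.tsum_le_tsum (receivedCore_summand_le ϱχ D σ P X ϱ C z) (summable_receivedCore_summand ϱχ D σ P X ϱ C z)
    (summable_coreKernel' P z)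

variable {P} in
/-- ★ **THE UNIVERSAL CORE SUM IS UNIFORMLY BOUNDED** on an `s`-separated reference: `Σ'_{y ≠ z} (d⁻¹² + d⁻⁶) ≤ 1024/(s³s⁹) + 1024/(s³s³)`
at every reference site `z` (far-field packing sums `ExcessDecayLiouville.sum_inv_pow_le_of_separated` with `R = δ = s`). -/
theorem tsum_coreKernel_le {s : ℝ} (hP : IsSeparatedRef s P) (hs : 0 < s) {z : E3} (hz : z ∈ P.points) :
    ∑' y : {y : E3 // y ∈ P.points ∧ y ≠ z}, coreKernel (dist (y : E3) z) ≤ 1024 / (s ^ 3 * s ^ 9) + 1024 / (s ^ 3 * s ^ 3) := by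
  refine (summable_coreKernel' P z).tsum_le_of_sum_le fun u => ?_
  have hsep' : ∀ a ∈ u.map (Function.Embedding.subtype _), ∀ b ∈ u.map (Function.Embedding.subtype _), a ≠ b → s ≤ dist a b := by
    intro a ha b hb hab
    rw [Finset.mem_map] at ha hb
    obtain ⟨a', _, rfl⟩ := ha
    obtain ⟨b', _, rfl⟩ := hb
    exact hP _ a'.2.1 _ b'.2.1 hab
  have hfar' : ∀ a ∈ u.map (Function.Embedding.subtype _), s ≤ dist a z := by
    intro a ha
    rw [Finset.mem_map] at ha
    obtain ⟨a', _, rfl⟩ := ha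
    exact hP _ a'.2.1 _ hz a'.2.2
  have h12 := ExcessDecayLiouville.sum_inv_pow_le_of_separated (u.map (Function.Embedding.subtype _)) z (k := 9) (by norm_num) hs le_rfl
    hsep' hfar'
  have h6 := ExcessDecayLiouville.sum_inv_pow_le_of_separated (u.map (Function.Embedding.subtype _)) z (k := 3) (by norm_num) hs le_rfl
    hsep' hfar'
  rw [Finset.sum_map] at h12 h6
  have e : ∀ y : {y : E3 // y ∈ P.points ∧ y ≠ z}, coreKernel (dist (y : E3) z) =
      (dist ((Function.Embedding.subtype _ y) : E3) z)⁻¹ ^ (9 + 3) + (dist ((Function.Embedding.subtype _ y) : E3) z)⁻¹ ^ (3 + 3) :=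
    fun y => rfl
  rw [Finset.sum_congr rfl fun y _ => e y, Finset.sum_add_distrib]
  exact add_le_add h12 h6

variable {P X C D}

/-- ★★ **THE CORE MASS INTO AN INVARIANT TARGET, REFOLDED**: for invariant `X`, `C`, `Dᵢ`, `Y`,
`coreMassL Y = Σ_{z ∈ F ∩ Y} receivedCore(z)` (P-W/P-Y refolding with the core kernel). -/
theorem coreMassL_refold (hX : IsInvariantSet P X) (hC : IsInvariantSet P C) (hD : ∀ i, IsInvariantSet P (D i)) {Y : Set E3}
    (hY : IsInvariantSet P Y) :
    coreMassL ϱχ D σ P X ϱ C Y = ∑ z ∈ P.motif, if z ∈ Y then receivedCore ϱχ D σ P X ϱ C z else 0 := by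
  set Φ : E3 → E3 → ℝ := fun y z =>
    (if y ∈ X then 0 else localFactor ϱχ D σ y * profileWeight ϱ C y) * (if z ∈ Y then coreKernel (dist y z) else 0) with hΦdef
  have h0 : ∀ y z, y ≠ z → 0 ≤ Φ y z := fun y z hyz => by
    simp only [hΦdef]
    refine mul_nonneg ?_ ?_
    · split_ifs
      · exact le_rfl
      · exact mul_nonneg (localFactor_nonneg (ϱχ := ϱχ) (D := D) (σ := σ) y) (profileWeight_nonneg ϱ C y)
    · split_ifs
      · exact coreKernel_nonneg (dist_pos.2 hyz)
      · exact le_rfl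
  -- the refolding lemma wants non-negativity everywhere: clip the (irrelevant) diagonal
  set Ψ : E3 → E3 → ℝ := fun y z => if y = z then 0 else Φ y z with hΨdef
  have hΨ0 : ∀ y z, 0 ≤ Ψ y z := fun y z => by
    simp only [hΨdef]
    split_ifs with h
    · exact le_rfl
    · exact h0 y z h
  have hΨΦ : ∀ y z, y ≠ z → Ψ y z = Φ y z := fun y z h => by simp only [hΨdef, if_neg h]
  have hΦinv : ∀ g ∈ P.lattice, ∀ y z : E3, Φ (y + g) (z + g) = Φ y z := fun g hg y z => by
    simp only [hΦdef, hX g hg, hY g hg, localFactor_add_of_isInvariantSet ϱχ hD σ hg, profileWeight_add_of_isInvariantSet ϱ hC hg,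
      dist_add_right]
  have hΨinv : ∀ g ∈ P.lattice, ∀ y z : E3, Ψ (y + g) (z + g) = Ψ y z := fun g hg y z => by
    simp only [hΨdef, add_left_inj, hΦinv g hg]
  have hL : coreMassL ϱχ D σ P X ϱ C Y = ∑ y ∈ P.motif, ∑' z : {z : E3 // z ∈ P.points ∧ z ≠ y}, Ψ y z := by
    unfold coreMassL coreSum
    refine Finset.sum_congr rfl fun y _ => ?_
    rw [show (∑' z : {z : E3 // z ∈ P.points ∧ z ≠ y}, Ψ y z) = ∑' z : {z : E3 // z ∈ P.points ∧ z ≠ y}, Φ y z from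
      tsum_congr fun z => hΨΦ y z (fun h => z.2.2 h.symm)]
    simp only [hΦdef]
    rw [tsum_mul_left]
    split_ifs <;> ring
  have hR : (∑ z ∈ P.motif, if z ∈ Y then receivedCore ϱχ D σ P X ϱ C z else 0) =
      ∑ z ∈ P.motif, ∑' y : {y : E3 // y ∈ P.points ∧ y ≠ z}, Ψ y z := by
    refine Finset.sum_congr rfl fun z _ => ?_
    rw [show (∑' y : {y : E3 // y ∈ P.points ∧ y ≠ z}, Ψ y z) = ∑' y : {y : E3 // y ∈ P.points ∧ y ≠ z}, Φ y z from
      tsum_congr fun y => hΨΦ y z y.2.2]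
    by_cases hz : z ∈ Y
    · rw [if_pos hz, receivedCore]
      refine tsum_congr fun y => ?_
      simp only [hΦdef, if_pos hz]
      split_ifs <;> ring
    · rw [if_neg hz]
      symm
      refine (tsum_congr fun y => ?_).trans tsum_zero
      simp only [hΦdef, if_neg hz, mul_zero]
  have h1 : ∀ y ∈ P.motif, Summable fun z : {z : E3 // z ∈ P.points ∧ z ≠ y} => Ψ y z := fun y _ => by
    refine (((summable_coreSummand P Y y).mul_left (if y ∈ X then 0 else localFactor ϱχ D σ y * profileWeight ϱ C y)).congr
      fun z => ?_)
    rw [hΨΦ y z (fun h => z.2.2 h.symm)]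
  have h2 : ∀ z ∈ P.motif, Summable fun y : {y : E3 // y ∈ P.points ∧ y ≠ z} => Ψ y z := fun z _ => by
    by_cases hz : z ∈ Y
    · have hs := summable_receivedCore_summand ϱχ D σ P X ϱ C z
      refine (hs.congr fun y => ?_)
      rw [hΨΦ y z y.2.2]
      simp only [hΦdef, if_pos hz]
      split_ifs <;> ring
    · refine (summable_zero.congr fun y => ?_)
      rw [hΨΦ y z y.2.2]
      simp only [hΦdef, if_neg hz, mul_zero]
  rw [hL, hR]
  exact sum_tsum_refold_real P Ψ hΨ0 hΨinv h1 h2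

/-- ★★ **NEAR-CORE CHARGING**: for invariant data on an `s`-separated reference, the core mass received in the near zone is at most
`(1024/(s³s⁹) + 1024/(s³s³))·pricedNearCountL` — every priced excised motif site receives at most the universal core sum. -/
theorem coreMassL_near_le {s : ℝ} (hP : IsSeparatedRef s P) (hs : 0 < s) (hX : IsInvariantSet P X) (hC : IsInvariantSet P C)
    (hD : ∀ i, IsInvariantSet P (D i)) :
    coreMassL ϱχ D σ P X ϱ C (X ∩ nearZone ϱχ D σ P X ϱ C) ≤
      (1024 / (s ^ 3 * s ^ 9) + 1024 / (s ^ 3 * s ^ 3)) * (pricedNearCountL ϱχ D σ P X ϱ C : ℝ) := by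
  have hN := isInvariantSet_nearZone ϱχ σ ϱ hX hC hD
  rw [coreMassL_refold ϱχ σ ϱ hX hC hD (hX.inter_set hN), pricedNearCountL_eq_card]
  refine le_trans (Finset.sum_le_sum (g := fun z => if z ∈ X ∩ nearZone ϱχ D σ P X ϱ C then
    1024 / (s ^ 3 * s ^ 9) + 1024 / (s ^ 3 * s ^ 3) else (0 : ℝ)) fun z hz => ?_) (le_of_eq ?_)
  · split_ifs
    · exact (receivedCore_le_univ ϱχ D σ P X ϱ C z).trans (tsum_coreKernel_le hP hs (P.mem_points_of_mem_motif hz))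
    · exact le_rfl
  · rw [Finset.sum_ite, Finset.sum_const_zero, add_zero, Finset.sum_const, nsmul_eq_mul, mul_comm]

end CoreRefold

end Summit.AtomisticToContinuum.Crystallization.Theorems.ChargedEnergyGapChartDial

end
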